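import Summits.BirchSwinnertonDyer.BirchSwinnertonDyer.Theorems.ByReductionTypeAtTwoMultTransportTwistedDescentLocalKummer
import HarnessLib

/-!
# T-42-mult in the kernel, XXXI: «`Im(κ_K) ⊆ Im(λ_K)`» at a multiplicative place in LOCAL cochain form —
# a Kummer coboundary `τ ↦ ι⁻¹(τQ − Q)` is `C`-valued modulo a coboundary (the prime `2` included)

Cell `bsd-2adic` (run/shared/lean/pub/bsd-2adic/), seat `bsd-2adic-t42` (BRIEF-T42), GEN 17. HONEST FRAMING:
research route; THEOREMS ONLY (no `def`, no named fact, no instance); nothing booked; nothing re-keyed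
(RC-169); BSD is not proved by any of this. PARTITION: X5@2 multiplicative GV-transport rows (K4ᵐ B1·O1; the
LOCAL statement `T2` at the prime `2` — the last open input of `hF3b` after XXX `hF3b_of_prop49_T2`) × p = 2 —
types-the-object-of; bears_on K4 items 19922 / 19923 (`--supports stmt-BirchSwinnertonDyer-19923`).

## What (first brick of `T2`, HOME/t42/DESIGN-T42-ADDENDUM-17.md §A17.3 (T2))

`T2` (local descent at `2`, Greenberg p. 124 «`𝒫^Σ(M, F) → 𝒫^Σ(M, F_∞)^Γ` surjective») starts from the
hypothesis that `ψ_u c = u·conj_γ c − c` is a KUMMER class at the place above `2` and needs it in the form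
«`ψ_u c` dies in `H¹(G_K, E[p^∞]/C)`» (`K = (F_∞)_η`), i.e. the inclusion `Im(κ_K) ⊆ Im(λ_K)` of Greenberg's
Prop. 2.4-multiplicative — the converse of XXVII — in LOCAL COCHAIN form. The tree proves this inclusion for
odd `p` only (`X2.GreenbergVatsalTateDatumCofree.exists_data_of_(not_)split`, `hp2 : p ≠ 2`, via the inertia
lemma `tateDatum_kummer`). Here, for Tate-parametrisation data `(q, t, Ψ)` (twisted equivariance
`σΨ(u) = χ(σ)Ψ(σu)`, `χ(σ) = ±1` according as `σt = ±t`) and the Tate line `C = ι⁻¹Ψ(μ)`: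

* `mem_plus_of_eq_smul_sub_of_smul_eq` — for ANY `τ ∈ Γ_{F_v}` fixing `t` (so `τΨ(u) = Ψ(τu)`), ANY point
  `Q ∈ E(F̄_v)` and any `m ∈ E[p^∞]` with `ι m = τQ − Q`: `m ∈ C`. (Verbatim the argument of
  `tateDatum_kummer`, which is stated for inertial `τ` but uses only `|τx|_v = |x|_v`: `Q = Ψ(u)`,
  `τQ − Q = Ψ(τu/u)`, `(τu/u)^{p^k} ∈ q^ℤ` and `|τu/u|_v = 1 > |q|_v` force `τu/u ∈ μ`.) Any `p`.
* **`exists_sub_coboundary_mem_plus`** (`p = 2`) — for a subgroup `G ≤ Γ_{F_v}`, a point `Q` and a map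
  `k : G → E[2^∞]` with `ι(k τ) = τQ − Q` for all `τ ∈ G`, there is `m₀ ∈ E[2^∞]` with
  `k τ − (τ m₀ − m₀) ∈ C` for all `τ ∈ G`. If some `τ₁ ∈ G` moves `t` (non-split at the completion): with
  `Q = Ψ(u)`, `(τ₁u·u)^{2^{k₁}} = q^a`, take `m₀ = ι⁻¹Ψ(w)`, `w^{2^{k₁+1}} = q^a` (a `2`-power torsion point —
  this is where `p = 2` is used); for `τt = t` both `k τ` and `τm₀ − m₀` lie in `C`, for `τt = −t` the
  difference is `Ψ((τw·w)/(τu·u))`, a root of unity by the valuation count `2a·2^{k_τ} = a_τ·2^{k₁+1}`.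

References: [GreenbergLNM1716] §2 Prop. 2.4, pp. 74–76 («`Im(κ_K) = Im(λ_K)` … can be verified quite directly
by using the Tate parametrization»); [GreenbergVatsal2000] §2 pp. 14–15; [SilvermanATAEC1994] V.3.1, V.5.2–5.4.
-/

set_option autoImplicit false
set_option linter.dupNamespace false

noncomputable section

open scoped Classical

namespace Summit.BirchSwinnertonDyer.BirchSwinnertonDyer.Theorems.MultTransportTwistedDescent

open NumberField IsDedekindDomain Field WeierstrassCurve
  Literature.NumberTheory.GaloisRepresentations Literature.NumberTheory.EllipticCurves
  Literature.NumberTheory.EllipticCurves.GreenbergSelmer IsDedekindDomain.HeightOneSpectrum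
  Summit.BirchSwinnertonDyer.Rank1Residual.X2

section TateData

variable {F : Type} [Field F] [NumberField F] (W : WeierstrassCurve F) [W.IsElliptic] (p : ℕ)
  [hp : Fact p.Prime] {v : HeightOneSpectrum (𝓞 F)}
  (Ψ : Additive (AlgebraicClosure (v.adicCompletion F))ˣ →+ localPoints W (v.adicCompletion F))
  (t : AlgebraicClosure (v.adicCompletion F)) {q : v.adicCompletion F}
  (hq0 : q ≠ 0) (hq1 : Valued.v q < 1)
  (hker : ∀ u : (AlgebraicClosure (v.adicCompletion F))ˣ, Ψ (Additive.ofMul u) = 0 ↔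
    ∃ a : ℤ, (u : AlgebraicClosure (v.adicCompletion F)) =
      algebraMap (v.adicCompletion F) (AlgebraicClosure (v.adicCompletion F)) q ^ a)
  (hΨσ : ∀ (σ : absoluteGaloisGroup (v.adicCompletion F))
      (u : (AlgebraicClosure (v.adicCompletion F))ˣ),
    σ • Ψ (Additive.ofMul u) =
      (if Field.absoluteGaloisGroup.toAlgEquiv (v.adicCompletion F) σ t = t then (1 : ℤ)
        else -1) •
      Ψ (Additive.ofMul (Units.map
        (Field.absoluteGaloisGroup.toAlgEquiv (v.adicCompletion F) σ :
          AlgebraicClosure (v.adicCompletion F) →* AlgebraicClosure (v.adicCompletion F)) u)))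
  (hsurj : Function.Surjective Ψ)
  (N : LocalDatum F (W.geomPrimaryTorsion p) v)
  (hN : ∀ m : W.geomPrimaryTorsion p, m ∈ N.plus ↔
    ∃ ζ : (AlgebraicClosure (v.adicCompletion F))ˣ, IsOfFinOrder ζ ∧
      Ψ (Additive.ofMul ζ) = pointsMap W (v.adicCompletion F) (m : W.geomPoints))

omit [W.IsElliptic] in
include hq0 hq1 in
/-- A unit `x` of `F̄_v` of spectral valuation `1` some power of which lies in `q^ℤ` is a root of unity
(`|q|_v < 1`). [cite: SilvermanATAEC1994, Ch. V Thm. 3.1 (c),(d)] -/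
theorem isOfFinOrder_of_pow_eq_zpow {w : Valuation (AlgebraicClosure (v.adicCompletion F)) NNReal}
    (hw : ∀ x, (w x : ℝ) = spectralNorm (v.adicCompletion F) (AlgebraicClosure (v.adicCompletion F)) x)
    {x : (AlgebraicClosure (v.adicCompletion F))ˣ} (hx : w (x : AlgebraicClosure (v.adicCompletion F)) = 1)
    {n : ℕ} (hn : 0 < n) {a : ℤ}
    (ha : ((x ^ n : (AlgebraicClosure (v.adicCompletion F))ˣ) : AlgebraicClosure (v.adicCompletion F)) =
      algebraMap (v.adicCompletion F) (AlgebraicClosure (v.adicCompletion F)) q ^ a) :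
    IsOfFinOrder x := by
  have hq' : algebraMap (v.adicCompletion F) (AlgebraicClosure (v.adicCompletion F)) q ≠ 0 :=
    (map_ne_zero_iff _ (algebraMap (v.adicCompletion F)
      (AlgebraicClosure (v.adicCompletion F))).injective).2 hq0
  have hwq0 : 0 < w (algebraMap (v.adicCompletion F) (AlgebraicClosure (v.adicCompletion F)) q) :=
    zero_lt_iff.2 ((map_ne_zero w).2 hq')
  have hwq : w (algebraMap (v.adicCompletion F) (AlgebraicClosure (v.adicCompletion F)) q) < 1 := by
    rw [← NNReal.coe_lt_coe, coe_spectralValuation_algebraMap hw, NNReal.coe_one]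
    exact Valued.toNormedField.norm_lt_one_iff.mpr hq1
  have hpow : w (algebraMap (v.adicCompletion F) (AlgebraicClosure (v.adicCompletion F)) q) ^ a =
      w (algebraMap (v.adicCompletion F) (AlgebraicClosure (v.adicCompletion F)) q) ^ (0 : ℤ) := by
    rw [zpow_zero, ← map_zpow₀, ← ha, Units.val_pow_eq_pow_val, map_pow, hx, one_pow]
  have ha0 : a = 0 := (zpow_right_strictAnti₀ hwq0 hwq).injective hpow
  rw [ha0, zpow_zero] at ha
  have : x ^ n = 1 := Units.ext ha
  exact isOfFinOrder_iff_pow_eq_one.2 ⟨n, hn, this⟩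

omit [W.IsElliptic] in
include hq0 hq1 hker hΨσ hsurj hN in
/-- **A Kummer coboundary value at an element fixing `t` lies in `C`** (any `p`): for `τ ∈ Γ_{F_v}` with
`τ t = t` (so that `Ψ` is `τ`-equivariant), any `Q ∈ E(F̄_v)` and `m ∈ E[p^∞]` with `ι m = τQ − Q`, `m ∈ C`.
Verbatim `X2.GreenbergVatsalTateDatum.tateDatum_kummer` (there for inertial `τ`; only `|τx|_v = |x|_v` is
used). [cite: GreenbergLNM1716, §2 p. 76] [cite: GreenbergVatsal2000, §2 pp. 14–15] -/
theorem mem_plus_of_eq_smul_sub_of_smul_eq (τ : absoluteGaloisGroup (v.adicCompletion F))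
    (hτ : Field.absoluteGaloisGroup.toAlgEquiv (v.adicCompletion F) τ t = t)
    (Q : localPoints W (v.adicCompletion F)) (m : W.geomPrimaryTorsion p)
    (hm : pointsMap W (v.adicCompletion F) (m : W.geomPoints) = τ • Q - Q) : m ∈ N.plus := by
  obtain ⟨u, rfl⟩ := hsurj Q
  obtain ⟨u', rfl⟩ : ∃ u' : (AlgebraicClosure (v.adicCompletion F))ˣ, Additive.ofMul u' = u :=
    ⟨Additive.toMul u, ofMul_toMul u⟩
  obtain ⟨k, hk⟩ := (AddCommGroup.mem_primaryComponent).1 m.2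
  have hΨτ : τ • Ψ (Additive.ofMul u') = Ψ (Additive.ofMul (Units.map
      (Field.absoluteGaloisGroup.toAlgEquiv (v.adicCompletion F) τ :
        AlgebraicClosure (v.adicCompletion F) →* AlgebraicClosure (v.adicCompletion F)) u')) := by
    rw [hΨσ, if_pos hτ, one_zsmul]
  set ζ : (AlgebraicClosure (v.adicCompletion F))ˣ :=
    Units.map (Field.absoluteGaloisGroup.toAlgEquiv (v.adicCompletion F) τ :
      AlgebraicClosure (v.adicCompletion F) →* AlgebraicClosure (v.adicCompletion F)) u' * u'⁻¹
    with hζdef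
  have hζΨ : Ψ (Additive.ofMul ζ) = pointsMap W (v.adicCompletion F) (m : W.geomPoints) := by
    rw [hm, hζdef, ofMul_mul, ofMul_inv, map_add, map_neg, ← hΨτ, sub_eq_add_neg]
  have h0 : Ψ (Additive.ofMul (ζ ^ p ^ k)) = 0 := by
    rw [ofMul_pow, map_nsmul, hζΨ, ← map_nsmul, hk, map_zero]
  obtain ⟨a, ha⟩ := (hker _).1 h0
  obtain ⟨w, hw⟩ := v.exists_spectralValuation
  have hu0 : w (u' : AlgebraicClosure (v.adicCompletion F)) ≠ 0 := (map_ne_zero w).2 u'.ne_zero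
  have hwζ : w (ζ : AlgebraicClosure (v.adicCompletion F)) = 1 := by
    rw [hζdef, Units.val_mul, map_mul, Units.coe_map, MonoidHom.coe_coe,
      ← Field.absoluteGaloisGroup.smul_def, spectralValuation_smul hw, Units.val_inv_eq_inv_val,
      map_inv₀, mul_inv_cancel₀ hu0]
  rw [hN]
  exact ⟨ζ, isOfFinOrder_of_pow_eq_zpow hq0 hq1 hw hwζ (pow_pos hp.out.pos k) ha, hζΨ⟩

end TateData

/-! ## The prime `2`: a Kummer coboundary is `C`-valued modulo a coboundary -/

section Two

variable {F : Type} [Field F] [NumberField F] (W : WeierstrassCurve F) [W.IsElliptic]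
  {v : HeightOneSpectrum (𝓞 F)}
  (Ψ : Additive (AlgebraicClosure (v.adicCompletion F))ˣ →+ localPoints W (v.adicCompletion F))
  (t : AlgebraicClosure (v.adicCompletion F)) {q : v.adicCompletion F}
  (hq0 : q ≠ 0) (hq1 : Valued.v q < 1)
  (hker : ∀ u : (AlgebraicClosure (v.adicCompletion F))ˣ, Ψ (Additive.ofMul u) = 0 ↔
    ∃ a : ℤ, (u : AlgebraicClosure (v.adicCompletion F)) =
      algebraMap (v.adicCompletion F) (AlgebraicClosure (v.adicCompletion F)) q ^ a)
  (hΨσ : ∀ (σ : absoluteGaloisGroup (v.adicCompletion F))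
      (u : (AlgebraicClosure (v.adicCompletion F))ˣ),
    σ • Ψ (Additive.ofMul u) =
      (if Field.absoluteGaloisGroup.toAlgEquiv (v.adicCompletion F) σ t = t then (1 : ℤ)
        else -1) •
      Ψ (Additive.ofMul (Units.map
        (Field.absoluteGaloisGroup.toAlgEquiv (v.adicCompletion F) σ :
          AlgebraicClosure (v.adicCompletion F) →* AlgebraicClosure (v.adicCompletion F)) u)))
  (hts : ∀ σ : absoluteGaloisGroup (v.adicCompletion F), σ • t = t ∨ σ • t = -t)
  (hsurj : Function.Surjective Ψ)
  (N : LocalDatum F (W.geomPrimaryTorsion 2) v)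
  (hN : ∀ m : W.geomPrimaryTorsion 2, m ∈ N.plus ↔
    ∃ ζ : (AlgebraicClosure (v.adicCompletion F))ˣ, IsOfFinOrder ζ ∧
      Ψ (Additive.ofMul ζ) = pointsMap W (v.adicCompletion F) (m : W.geomPoints))

include hq0 hq1 hker hΨσ hts hsurj hN in
/-- **«`Im(κ_K) ⊆ Im(λ_K)`» in local cochain form at the prime `2`**: for a subgroup `G ≤ Γ_{F_v}`, a point
`Q ∈ E(F̄_v)` and `k : G → E[2^∞]` with `ι(k τ) = τQ − Q` on `G` (a Kummer coboundary with `2`-power torsion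
values), there is `m₀ ∈ E[2^∞]` with `k τ − (τ m₀ − m₀) ∈ C` for all `τ ∈ G` — the class of `k` dies in
`H¹(G, E[2^∞]/C)`. See the module docstring for the proof (twisted Tate parametrisation, valuations).
[cite: GreenbergLNM1716, §2 Prop. 2.4, pp. 74–76] [cite: GreenbergVatsal2000, §2 pp. 14–15] -/
theorem exists_sub_coboundary_mem_plus (G : Subgroup (absoluteGaloisGroup (v.adicCompletion F)))
    (Q : localPoints W (v.adicCompletion F)) (k : G → W.geomPrimaryTorsion 2)
    (hk : ∀ τ : G, pointsMap W (v.adicCompletion F) (k τ : W.geomPoints) =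
      (τ : absoluteGaloisGroup (v.adicCompletion F)) • Q - Q) :
    ∃ m₀ : W.geomPrimaryTorsion 2, ∀ τ : G,
      k τ - (resGal (K := F) (v.adicCompletion F) (τ : absoluteGaloisGroup (v.adicCompletion F)) • m₀ - m₀)
        ∈ N.plus := by
  -- notation
  obtain ⟨u, rfl⟩ := hsurj Q
  obtain ⟨u, rfl⟩ : ∃ u' : (AlgebraicClosure (v.adicCompletion F))ˣ, Additive.ofMul u' = u :=
    ⟨Additive.toMul u, ofMul_toMul u⟩
  obtain ⟨w, hw⟩ := v.exists_spectralValuation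
  have hq' : algebraMap (v.adicCompletion F) (AlgebraicClosure (v.adicCompletion F)) q ≠ 0 :=
    (map_ne_zero_iff _ (algebraMap (v.adicCompletion F)
      (AlgebraicClosure (v.adicCompletion F))).injective).2 hq0
  have hwq0 : 0 < w (algebraMap (v.adicCompletion F) (AlgebraicClosure (v.adicCompletion F)) q) :=
    zero_lt_iff.2 ((map_ne_zero w).2 hq')
  have hwq : w (algebraMap (v.adicCompletion F) (AlgebraicClosure (v.adicCompletion F)) q) < 1 := by
    rw [← NNReal.coe_lt_coe, coe_spectralValuation_algebraMap hw, NNReal.coe_one]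
    exact Valued.toNormedField.norm_lt_one_iff.mpr hq1
  -- abbreviations for the Galois action on units
  have hsm : ∀ (σ : absoluteGaloisGroup (v.adicCompletion F)) (x : (AlgebraicClosure (v.adicCompletion F))ˣ),
      ((Units.map (Field.absoluteGaloisGroup.toAlgEquiv (v.adicCompletion F) σ :
        AlgebraicClosure (v.adicCompletion F) →* AlgebraicClosure (v.adicCompletion F)) x :
          (AlgebraicClosure (v.adicCompletion F))ˣ) : AlgebraicClosure (v.adicCompletion F)) =
        σ • (x : AlgebraicClosure (v.adicCompletion F)) := fun σ x ↦ rfl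
  have hwsm : ∀ (σ : absoluteGaloisGroup (v.adicCompletion F))
      (x : (AlgebraicClosure (v.adicCompletion F))ˣ),
      w ((Units.map (Field.absoluteGaloisGroup.toAlgEquiv (v.adicCompletion F) σ :
        AlgebraicClosure (v.adicCompletion F) →* AlgebraicClosure (v.adicCompletion F)) x :
          (AlgebraicClosure (v.adicCompletion F))ˣ) : AlgebraicClosure (v.adicCompletion F)) =
        w (x : AlgebraicClosure (v.adicCompletion F)) := fun σ x ↦ by
    rw [hsm, spectralValuation_smul hw]
  have hqfix : ∀ (σ : absoluteGaloisGroup (v.adicCompletion F)) (a : ℤ),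
      σ • (algebraMap (v.adicCompletion F) (AlgebraicClosure (v.adicCompletion F)) q ^ a) =
        algebraMap (v.adicCompletion F) (AlgebraicClosure (v.adicCompletion F)) q ^ a := fun σ a ↦ by
    rw [Field.absoluteGaloisGroup.smul_def, map_zpow₀, AlgEquiv.commutes]
  -- the sign of `τ`
  have hsign : ∀ τ : absoluteGaloisGroup (v.adicCompletion F),
      Field.absoluteGaloisGroup.toAlgEquiv (v.adicCompletion F) τ t = t ∨
        Field.absoluteGaloisGroup.toAlgEquiv (v.adicCompletion F) τ t = -t := fun τ ↦ by
    simpa only [Field.absoluteGaloisGroup.smul_def] using hts τ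
  by_cases hsplit : ∀ τ : G,
      Field.absoluteGaloisGroup.toAlgEquiv (v.adicCompletion F) (τ : absoluteGaloisGroup (v.adicCompletion F)) t = t
  · -- every `τ ∈ G` fixes `t`: `k` is `C`-valued on the nose
    refine ⟨0, fun τ ↦ ?_⟩
    rw [smul_zero, sub_zero, sub_zero]
    exact mem_plus_of_eq_smul_sub_of_smul_eq W 2 Ψ t hq0 hq1 hker hΨσ hsurj N hN _ (hsplit τ)
      (Ψ (Additive.ofMul u)) (k τ) (hk τ)
  · -- some `τ₁ ∈ G` moves `t`
    push Not at hsplit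
    obtain ⟨τ₁, hτ₁⟩ := hsplit
    have hτ₁' : Field.absoluteGaloisGroup.toAlgEquiv (v.adicCompletion F)
        (τ₁ : absoluteGaloisGroup (v.adicCompletion F)) t = -t := (hsign τ₁).resolve_left hτ₁
    -- `(τ₁u·u)^{2^{k₁}} = q^a`
    obtain ⟨k₁, hk₁⟩ := (AddCommGroup.mem_primaryComponent).1 (k τ₁).2
    set x₁ : (AlgebraicClosure (v.adicCompletion F))ˣ :=
      Units.map (Field.absoluteGaloisGroup.toAlgEquiv (v.adicCompletion F) τ₁ :
        AlgebraicClosure (v.adicCompletion F) →* AlgebraicClosure (v.adicCompletion F)) u * u with hx₁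
    have hkτ₁ : pointsMap W (v.adicCompletion F) (k τ₁ : W.geomPoints) = -Ψ (Additive.ofMul x₁) := by
      rw [hk τ₁, hΨσ, if_neg hτ₁, neg_one_zsmul, hx₁, ofMul_mul, map_add]; abel
    have h01 : Ψ (Additive.ofMul (x₁ ^ 2 ^ k₁)) = 0 := by
      have h := congrArg (fun P ↦ pointsMap W (v.adicCompletion F) (P : W.geomPoints)) hk₁
      simp only [map_nsmul, hkτ₁, map_zero, smul_neg, neg_eq_zero] at h
      rw [ofMul_pow, map_nsmul, h]
    obtain ⟨a, ha⟩ := (hker _).1 h01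
    -- `w`: a `2^{k₁+1}`-th root of `q^a`; `m₀ = ι⁻¹ Ψ(w)`
    obtain ⟨wr, hwr⟩ := IsAlgClosed.exists_pow_nat_eq
      (algebraMap (v.adicCompletion F) (AlgebraicClosure (v.adicCompletion F)) q ^ a) (pow_pos two_pos (k₁ + 1))
    have hwr0 : wr ≠ 0 := by
      rintro rfl
      rw [zero_pow (pow_ne_zero _ two_ne_zero)] at hwr
      exact zpow_ne_zero a hq' hwr.symm
    set wu : (AlgebraicClosure (v.adicCompletion F))ˣ := Units.mk0 wr hwr0 with hwu
    have hwun : ((wu ^ 2 ^ (k₁ + 1) : (AlgebraicClosure (v.adicCompletion F))ˣ) :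
        AlgebraicClosure (v.adicCompletion F)) =
        algebraMap (v.adicCompletion F) (AlgebraicClosure (v.adicCompletion F)) q ^ a := by
      rw [Units.val_pow_eq_pow_val, hwu, Units.val_mk0, hwr]
    have hΨq : ∀ b : ℤ, Ψ (Additive.ofMul ((Units.mk0 _ hq') ^ b)) = 0 := fun b ↦
      (hker _).2 ⟨b, by rw [Units.val_zpow_eq_zpow_val, Units.val_mk0]⟩
    have hΨw : 2 ^ (k₁ + 1) • Ψ (Additive.ofMul wu) = 0 := by
      rw [← map_nsmul, ← ofMul_pow]
      have : wu ^ 2 ^ (k₁ + 1) = (Units.mk0 _ hq') ^ a := Units.ext (by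
        rw [hwun, Units.val_zpow_eq_zpow_val, Units.val_mk0])
      rw [this]; exact hΨq a
    obtain ⟨m₀, hm₀⟩ := GreenbergVatsalTateDatumCofree.exists_primaryTorsion_pointsMap_eq W 2
      (Ψ (Additive.ofMul wu)) (k₁ + 1) hΨw
    refine ⟨m₀, fun τ ↦ ?_⟩
    -- the valuation of `u`: `|u|^{2^{k₁+1}} = |q|^a`
    have hwu_val : w (u : AlgebraicClosure (v.adicCompletion F)) ^ (2 ^ (k₁ + 1)) =
        w (algebraMap (v.adicCompletion F) (AlgebraicClosure (v.adicCompletion F)) q) ^ a := by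
      rw [← map_zpow₀, ← ha, Units.val_pow_eq_pow_val, map_pow, hx₁, Units.val_mul, map_mul, hwsm,
        ← pow_two, ← pow_mul, pow_succ']
    obtain ⟨kτ, hkτ⟩ := (AddCommGroup.mem_primaryComponent).1 (k τ).2
    rw [hN]
    rcases hsign τ with hτ | hτ
    · -- `τ t = t`: both `k τ` and `τ m₀ − m₀` lie in `C`
      have h1 : k τ ∈ N.plus := mem_plus_of_eq_smul_sub_of_smul_eq W 2 Ψ t hq0 hq1 hker hΨσ hsurj N hN _ hτ
        (Ψ (Additive.ofMul u)) (k τ) (hk τ)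
      have h2 : resGal (K := F) (v.adicCompletion F) (τ : absoluteGaloisGroup (v.adicCompletion F)) • m₀ - m₀
          ∈ N.plus := by
        refine mem_plus_of_eq_smul_sub_of_smul_eq W 2 Ψ t hq0 hq1 hker hΨσ hsurj N hN _ hτ
          (Ψ (Additive.ofMul wu)) _ ?_
        rw [AddSubgroupClass.coe_sub, map_sub, primaryComponent.coe_smul, pointsMap_smul, hm₀]
      rw [← hN]
      exact N.plus.sub_mem h1 h2
    · -- `τ t = −t`: the difference is `Ψ((τw·w)/(τu·u))`, a root of unity
      set xτ : (AlgebraicClosure (v.adicCompletion F))ˣ :=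
        Units.map (Field.absoluteGaloisGroup.toAlgEquiv (v.adicCompletion F) τ :
          AlgebraicClosure (v.adicCompletion F) →* AlgebraicClosure (v.adicCompletion F)) u * u with hxτ
      set wτ : (AlgebraicClosure (v.adicCompletion F))ˣ :=
        Units.map (Field.absoluteGaloisGroup.toAlgEquiv (v.adicCompletion F) τ :
          AlgebraicClosure (v.adicCompletion F) →* AlgebraicClosure (v.adicCompletion F)) wu * wu with hwτ
      have hτne : Field.absoluteGaloisGroup.toAlgEquiv (v.adicCompletion F)
          (τ : absoluteGaloisGroup (v.adicCompletion F)) t ≠ t := by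
        intro h
        rw [h] at hτ
        -- `t = -t` forces `t = 0`, but then `τ₁ t = t`
        have ht0 : t = 0 := by
          have h2 : (2 : AlgebraicClosure (v.adicCompletion F)) * t = 0 := by rw [two_mul]; nth_rw 2 [hτ]; ring
          haveI : CharZero (v.adicCompletion F) := charZero_adicCompletion v
          rcases mul_eq_zero.1 h2 with h | h
          · exact absurd h two_ne_zero
          · exact h
        exact hτ₁ (by rw [ht0, map_zero])
      have hkτ' : pointsMap W (v.adicCompletion F) (k τ : W.geomPoints) = -Ψ (Additive.ofMul xτ) := by
        rw [hk τ, hΨσ, if_neg hτne, neg_one_zsmul, hxτ, ofMul_mul, map_add]; abel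
      have hcob : pointsMap W (v.adicCompletion F)
          ((resGal (K := F) (v.adicCompletion F) (τ : absoluteGaloisGroup (v.adicCompletion F)) • m₀ - m₀ :
            W.geomPrimaryTorsion 2) : W.geomPoints) = -Ψ (Additive.ofMul wτ) := by
        rw [AddSubgroupClass.coe_sub, map_sub, primaryComponent.coe_smul, pointsMap_smul, hm₀, hΨσ, if_neg hτne,
          neg_one_zsmul, hwτ, ofMul_mul, map_add]; abel
      -- `(τu·u)^{2^{kτ}} = q^{aτ}`
      have h0τ : Ψ (Additive.ofMul (xτ ^ 2 ^ kτ)) = 0 := by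
        have h := congrArg (fun P ↦ pointsMap W (v.adicCompletion F) (P : W.geomPoints)) hkτ
        simp only [map_nsmul, hkτ', map_zero, smul_neg, neg_eq_zero] at h
        rw [ofMul_pow, map_nsmul, h]
      obtain ⟨aτ, haτ⟩ := (hker _).1 h0τ
      -- valuation count: `aτ · 2^{k₁+1} = 2a · 2^{kτ}`
      have hval1 : w (u : AlgebraicClosure (v.adicCompletion F)) ^ (2 ^ (kτ + 1)) =
          w (algebraMap (v.adicCompletion F) (AlgebraicClosure (v.adicCompletion F)) q) ^ aτ := by
        rw [← map_zpow₀, ← haτ, Units.val_pow_eq_pow_val, map_pow, hxτ, Units.val_mul, map_mul, hwsm,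
          ← pow_two, ← pow_mul, pow_succ']
      have hexp : aτ * 2 ^ (k₁ + 1) = a * 2 ^ (kτ + 1) := by
        have e1 : w (algebraMap (v.adicCompletion F) (AlgebraicClosure (v.adicCompletion F)) q) ^
            (aτ * 2 ^ (k₁ + 1)) =
            w (algebraMap (v.adicCompletion F) (AlgebraicClosure (v.adicCompletion F)) q) ^ (a * 2 ^ (kτ + 1)) := by
          rw [zpow_mul, zpow_mul, ← hval1, ← hwu_val, ← zpow_natCast, ← zpow_natCast, ← zpow_mul, ← zpow_mul,
            mul_comm]
          push_cast
          ring_nf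
        exact (zpow_right_strictAnti₀ hwq0 hwq).injective e1
      -- the ratio `r = (τw·w)/(τu·u)` is a root of unity: `r^{2^{k₁+1+kτ+1}} = 1`
      set r : (AlgebraicClosure (v.adicCompletion F))ˣ := wτ * xτ⁻¹ with hr
      have hwτn : ((wτ ^ 2 ^ (k₁ + 1) : (AlgebraicClosure (v.adicCompletion F))ˣ) :
          AlgebraicClosure (v.adicCompletion F)) =
          algebraMap (v.adicCompletion F) (AlgebraicClosure (v.adicCompletion F)) q ^ (2 * a) := by
        rw [Units.val_pow_eq_pow_val, hwτ, Units.val_mul, mul_pow, hsm, ← smul_pow', ← Units.val_pow_eq_pow_val,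
          hwun, hqfix, ← zpow_add₀ hq', two_mul]
      have hwM : ((wτ : (AlgebraicClosure (v.adicCompletion F))ˣ) : AlgebraicClosure (v.adicCompletion F)) ^
          (2 ^ (k₁ + 1) * 2 ^ (kτ + 1)) =
          algebraMap (v.adicCompletion F) (AlgebraicClosure (v.adicCompletion F)) q ^
            (2 * a * ((2 ^ (kτ + 1) : ℕ) : ℤ)) := by
        rw [pow_mul, ← Units.val_pow_eq_pow_val, hwτn, ← zpow_natCast, ← zpow_mul]
      have hxM : ((xτ : (AlgebraicClosure (v.adicCompletion F))ˣ) : AlgebraicClosure (v.adicCompletion F)) ^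
          (2 ^ (k₁ + 1) * 2 ^ (kτ + 1)) =
          algebraMap (v.adicCompletion F) (AlgebraicClosure (v.adicCompletion F)) q ^
            (aτ * ((2 * 2 ^ (k₁ + 1) : ℕ) : ℤ)) := by
        rw [show 2 ^ (k₁ + 1) * 2 ^ (kτ + 1) = 2 ^ kτ * (2 * 2 ^ (k₁ + 1)) by ring, pow_mul,
          ← Units.val_pow_eq_pow_val, haτ, ← zpow_natCast, ← zpow_mul]
      have hexp' : 2 * a * ((2 ^ (kτ + 1) : ℕ) : ℤ) = aτ * ((2 * 2 ^ (k₁ + 1) : ℕ) : ℤ) := by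
        push_cast
        linear_combination 2 * hexp.symm
      have hrpow : r ^ (2 ^ (k₁ + 1) * 2 ^ (kτ + 1)) = 1 := Units.ext (by
        rw [Units.val_pow_eq_pow_val, hr, Units.val_mul, mul_pow, Units.val_inv_eq_inv_val, inv_pow, hwM, hxM,
          hexp', mul_inv_cancel₀ (zpow_ne_zero _ hq'), Units.val_one])
      refine ⟨r, isOfFinOrder_iff_pow_eq_one.2 ⟨_, Nat.mul_pos (pow_pos two_pos _) (pow_pos two_pos _), hrpow⟩,
        ?_⟩
      rw [AddSubgroupClass.coe_sub, map_sub, hkτ', hcob, hr, ofMul_mul, ofMul_inv, map_add, map_neg]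
      abel

end Two

end Summit.BirchSwinnertonDyer.BirchSwinnertonDyer.Theorems.MultTransportTwistedDescent

end
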